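import Summits.MatrixMultiplication.MatrixMultiplication.Theses.TetrahedronCarving
import Summits.MatrixMultiplication.MatrixMultiplication.Theorems.EdgePencilBimaximal
import Summits.MatrixMultiplication.MatrixMultiplication.Theorems.EdgePencilDanskin
import HarnessLib

/-!
# Skeleton (BC3) for the crux `TetraExcessZero` (item `stmt-MatrixMultiplication-26697`) of route
# `TetrahedronCarving` — line «blind-and-chord» (the R45.1 reshape of «rung-and-chord», generation 46)

`TetraExcessZero : ω(K₄) ≤ ω(2,1,2)` («re-inserting the sixth edge into the diamond costs nothing»). Notation
(`Theorems.EdgePencil*`): `X₄ = DTensorClass.asymptoticSpectrumDTensors ℂ 2` (the asymptotic spectrum of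
4-tensors over `ℂ`), `D_n = sixTetra ℂ n 1` (diamond), `T(K₄)_n = tetra ℂ n`, `P_2 = fun i ↦ [i 0 = i 1]`
(the EPR pair across parties `0,1`), `ψ = omegaRect ℂ 2 1 2 = ω(2,1,2)`, `T = omegaTetra ℂ = ω(K₄)`,
`χ(δ) = omegaSix ℂ δ`; E-coordinates of `φ ∈ X₄`: `p_φ = log₂ φ[P_2] ∈ [0,1]` (sight of the missing edge),
`d_φ = log₂ φ[D_2] ∈ [0, ψ]` (diamond rate) (`EdgePencilExponentConstancy`).

The registered line «rung-and-chord» (`Lines/rung_and_chord.lean`) reads the crux as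
`stub_sixRungPos ∧ stub_midTight` (one rung above the bottom ∧ chord tightness at the midpoint). Generation 45
proved (`EdgePencilBimaximal.excessZero_iff_dMaxBlind_and_midTight`) that the crux is EXACTLY

  `DMaxBlind ∧ MidTight`,  `DMaxBlind := ∀ φ ∈ X₄, d_φ = ψ → p_φ = 0`
  («every diamond-maximal spectral point is BLIND to the missing edge»),

with `SixRungPos ⟹ DMaxBlind` (`dMaxBlind_of_sixRungPos`) and NOT conversely (a rung is `(χ − ψ)(δ) = 0` at
some `δ > 0`; `DMaxBlind` is only the first-order germ `χ'(0⁺) = 0`, `dMaxBlind_iff_firstOrderFree`). This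
line therefore REPLACES the first stub by the weaker, `ω`-free, base-free `stub_dMaxBlind` and KEEPS
`stub_midTight` verbatim; the composition is the tree theorem `tetraExcessZero_of_dMaxBlind_of_midTight`
(the bimaximal point given by `MidTight` is diamond-maximal, hence blind, so `T = p + d = d = ψ`). The old
line factors through the new one (`old_line_factors`), so nothing is lost.

Why `DMaxBlind` and not its equivalent `FirstOrderFree := ∀ ε > 0, ∃ δ ∈ (0,1], χ(δ) ≤ ψ + εδ` as the
registered statement: (a) it is the LITERAL hypothesis of the tree composition; (b) every known sufficient
mechanism lands in it by a NAMED theorem — a rung (`dMaxBlind_of_sixRungPos`), a single instance of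
tropical domination `TROP(n, e ≥ 2)` with no star-convexity hypothesis (`dMaxBlind_of_trop`), and the primal
form (`dMaxBlind_of_firstOrderFree`, restated below as `blind_of_firstOrderFree`); (c) its negation
is ONE existential witness — a seeing diamond-maximal point `(p_φ > 0, d_φ = ψ)` — which is exactly the
refuter's target, whereas `¬FirstOrderFree` is an `∃ ε ∀ δ` statement about an infimum.

Both stubs are NECESSARY (`stubs_of_TetraExcessZero`; from the summit: `dMaxBlind_of_matrixMultiplication`,
`sixRungPos_and_midTight_of_matrixMultiplication`), neither implies the crux or `ω = 2` on its own
(BC3 probes `Lines_blind_and_chord_probes.lean`, every probe FAILS; separating planar-shadow worlds of the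
critic, STATUS l.2019: `G1 = hull{(1,2),(0,21/5),(1,39/10)} ⊨ DMaxBlind ∧ ¬MidTight ∧ ¬crux`,
`G2 = hull{(1,2),(1,9/2)} ⊨ MidTight ∧ ¬DMaxBlind ∧ ¬crux`).
-/

set_option linter.dupNamespace false

namespace Summit.MatrixMultiplication.MatrixMultiplication.Cruxes.TetraExcessZero.BlindAndChord

open Literature.Computability.AlgebraicComplexity
open Summit.MatrixMultiplication.MatrixMultiplication.Theorems.TetrahedronTensor
open Summit.MatrixMultiplication.MatrixMultiplication.Theorems.TetraDiagonal
open Summit.MatrixMultiplication.MatrixMultiplication.Theorems.EdgePencil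
open Summit.MatrixMultiplication.MatrixMultiplication.Theses.TetrahedronCarving

/-- **Stub 1 (diamond-maximal points are blind)**: every `φ ∈ X₄(ℂ)` with `d_φ = ψ` has `p_φ = 0` — no
spectral point that is optimal for the diamond `D` sees the missing edge `01` at a positive rate.
Equivalently (`EdgePencilDanskin.dMaxBlind_iff_firstOrderFree`) the ladder `χ` vanishes to first order at
`0`: `∀ ε > 0, ∃ δ ∈ (0,1], χ(δ) ≤ ψ + εδ`. NEC (`dMaxBlind_of_tetraExcessZero`,
`dMaxBlind_of_matrixMultiplication`); implied by the old stub (`dMaxBlind_of_sixRungPos`) and by any single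
`TROP(n, e ≥ 2)` (`dMaxBlind_of_trop`); open. [cite: Strassen1988, Thm. 3.8] -/
theorem stub_dMaxBlind :
    ∀ φ ∈ DTensorClass.asymptoticSpectrumDTensors ℂ 2,
      Real.logb 2 (φ (DTensorClass.mk (sixTetra ℂ 2 1))) = omegaRect ℂ 2 1 2 →
        Real.logb 2 (φ (DTensorClass.mk (fun i : Fin 4 → Fin 2 => (ind (i 0 = i 1) : ℂ)))) = 0 := by
  sorry

/-- **Stub 2 (midpoint tightness, verbatim from «rung-and-chord»)**: `ω(2,1,2) + ω(K₄) ≤ 2·χ(1/2)` — the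
half-edge tetrahedron is as expensive as the average of diamond and tetrahedron; equivalently a BIMAXIMAL
spectral point exists (`midTight_iff_exists_bimaximal`), equivalently asymptotic rank is multiplicative on the
one Kronecker product `[D_n]·[T(K₄)_n]` (`midTight_iff_asympRank_mul_eq`). NEC; open.
[cite: ChristandlVranaZuiddam2023, Prop. 1.6] -/
theorem stub_midTight : omegaRect ℂ 2 1 2 + omegaTetra ℂ ≤ 2 * omegaSix ℂ (1 / 2) := by
  sorry

/-! ## The composition: the crux BY NAME -/

/-- **THE SKELETON THEOREM** (kernel-checked seam, no `sorry` of its own): the crux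
`Theses.TetrahedronCarving.TetraExcessZero` (stmt-MatrixMultiplication-26697) concluded BY NAME from the two
stubs through `EdgePencilBimaximal.tetraExcessZero_of_dMaxBlind_of_midTight`.
[cite: LottiRomani1983, §2 (p. 174)] -/
theorem TetraExcessZero_of : TetraExcessZero :=
  tetraExcessZero_of_dMaxBlind_of_midTight stub_dMaxBlind stub_midTight

/-- Both stubs are NECESSARY: the crux implies each. [cite: LottiRomani1983, §2 (p. 174)] -/
theorem stubs_of_TetraExcessZero (h : TetraExcessZero) :
    (∀ φ ∈ DTensorClass.asymptoticSpectrumDTensors ℂ 2,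
      Real.logb 2 (φ (DTensorClass.mk (sixTetra ℂ 2 1))) = omegaRect ℂ 2 1 2 →
        Real.logb 2 (φ (DTensorClass.mk (fun i : Fin 4 → Fin 2 => (ind (i 0 = i 1) : ℂ)))) = 0) ∧
      omegaRect ℂ 2 1 2 + omegaTetra ℂ ≤ 2 * omegaSix ℂ (1 / 2) :=
  tetraExcessZero_iff_dMaxBlind_and_midTight.1 h

/-! ## Readings of stub 1 (sorry-free; they only document how a proof may arrive) -/

/-- **Lossless w.r.t. the old line**: the registered `stub_sixRungPos` (`∃ δ > 0, χ(δ) ≤ ψ`) implies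
`stub_dMaxBlind`'s statement. [cite: Strassen1988, Thm. 3.8] -/
theorem blind_of_sixRungPos (hr : ∃ δ : ℝ, 0 < δ ∧ omegaSix ℂ δ ≤ omegaRect ℂ 2 1 2) :
    ∀ φ ∈ DTensorClass.asymptoticSpectrumDTensors ℂ 2,
      Real.logb 2 (φ (DTensorClass.mk (sixTetra ℂ 2 1))) = omegaRect ℂ 2 1 2 →
        Real.logb 2 (φ (DTensorClass.mk (fun i : Fin 4 → Fin 2 => (ind (i 0 = i 1) : ℂ)))) = 0 :=
  dMaxBlind_of_sixRungPos ℂ hr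

/-- **Primal reading**: first-order vanishing of the ladder (`∀ ε > 0, ∃ δ ∈ (0,1], χ(δ) ≤ ψ + εδ`, a statement
about CONSTRUCTIONS) implies `stub_dMaxBlind`'s statement (and conversely, `dMaxBlind_iff_firstOrderFree`).
[cite: Zuiddam2018, Thm. 2.15] -/
theorem blind_of_firstOrderFree
    (hfree : ∀ ε : ℝ, 0 < ε → ∃ δ : ℝ, 0 < δ ∧ δ ≤ 1 ∧ omegaSix ℂ δ ≤ omegaRect ℂ 2 1 2 + ε * δ) :
    ∀ φ ∈ DTensorClass.asymptoticSpectrumDTensors ℂ 2,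
      Real.logb 2 (φ (DTensorClass.mk (sixTetra ℂ 2 1))) = omegaRect ℂ 2 1 2 →
        Real.logb 2 (φ (DTensorClass.mk (fun i : Fin 4 → Fin 2 => (ind (i 0 = i 1) : ℂ)))) = 0 :=
  dMaxBlind_of_firstOrderFree ℂ hfree

/-- **The old skeleton factors through this one**: `rung_and_chord = blind_and_chord ∘ dMaxBlind_of_sixRungPos`.
[cite: LottiRomani1983, §2 (p. 174)] -/
theorem old_line_factors (h₁ : ∃ δ : ℝ, 0 < δ ∧ omegaSix ℂ δ ≤ omegaRect ℂ 2 1 2)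
    (h₂ : omegaRect ℂ 2 1 2 + omegaTetra ℂ ≤ 2 * omegaSix ℂ (1 / 2)) : TetraExcessZero :=
  tetraExcessZero_of_dMaxBlind_of_midTight (dMaxBlind_of_sixRungPos ℂ h₁) h₂

end Summit.MatrixMultiplication.MatrixMultiplication.Cruxes.TetraExcessZero.BlindAndChord
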